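import Literature.AlgebraicGeometry.Frobenioids.BiratFrobeniusCompactCriterion
import Literature.AlgebraicGeometry.Frobenioids.Prop55SubRatStdRlfClosers
import Literature.AlgebraicGeometry.Frobenioids.PadicFrobenioidUnitGroups
import HarnessLib

/-!
# Frobenioids I, Prop. 5.5 (iii) "Finally", rationally standard type — the clause Def. 4.5 (iii)(b) for
# `C^rlf`: a Frobenius-compact object of `((C^rlf)^un-tr)^birat` from one of `(C^un-tr)^birat` (PROOFS)

Mochizuki, *The geometry of Frobenioids I: the general theory*, Kyushu J. Math. **62** (2008) 293–400,
§5, proof of Proposition 5.5 (iii), kurims p. 105 ll. 20–22: "Now suppose that `C`, hence also `C^un-tr`,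
`C^rlf`, are not of group-like type. Since `(C^un-tr)^birat` admits a Frobenius-compact object, the same is
true for `(C^rlf)^birat`."; Def. 1.2 (iv) p. 23 (Frobenius-compact: `O^×(A)` commutative, `O^×(A)^pf ≠ 0`, and
an automorphism of `A` acting on `O^×(A)^pf` by multiplication by `λ ∈ ℚ_{>0}` acts trivially); Def. 4.5
(iii)(b) p. 86; Prop. 5.3 p. 103 (`C^rlf` = the model Frobenioid of `(Φ^rlf, ℝ · Φ^birat)`).
[cite: MochizukiFrdI2008, Prop. 5.5 (iii) p.105]

PROOF-ONLY (cell abc-iut, sub-DAG `plan/L1/SUBDAG-FrdI-Thm51iv-Prop55.md`, row **P55-L07c/K** = the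
hypothesis `hK` of `FrdI.Prop55Sub.prop55iii_untr_rlf_ratStd'_of` (seat abc-iut-w5-d250,
`Prop55SubRatStdRlfClosers.lean`); holder abc-iut-L1-t2).  The printed sentence, unpacked as the TRANSFER of
the `λ`-rigidity of Def. 1.2 (iv) from a Frobenius-compact `Y₀ = A₀^birat ∈ (C^un-tr)^birat` over
`X := Base(A₀)` to `Y := ((X, c)^un-tr)^birat ∈ ((C^rlf)^un-tr)^birat` (any class `c`), through the divisor
isomorphisms `Div : O^×(A^birat) ⥲ Φ^birat(X)` of `C^un-tr` and of `(C^rlf)^un-tr` (seat abc-iut-L1-d5,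
`divHom_untr_injective` / `range_divHom_untr`), the conjugation formula `Div(f u f⁻¹) = Base(f⁻¹)^* Div(u)`
(seat abc-iut-w4-d020; seat abc-iut-L6-t10's `Birat.exists_biratUnits_conj`) and the injective, natural map
`ι : Φ^gp(X) → (Φ^rlf)^gp(X)` carrying `Φ^birat(X)` into `ℝ · Φ^birat(X) = (Φ^rlf)^birat(X)` (seats
abc-iut-L1-d2 / w4-d084 / L6-t10: `toRlfNatTrans_app_injective` + `MonGp.map_injective`, `toRlfGp_mem_realSpan`,
`ModelFrobenioid.mem_biratSubgroup_iff_exists_divB`):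

* `pnat_eq_of_pow_scaling` — in a commutative group, a non-torsion `d` with `P^N = d^N` and
  `P^{qM} = d^{pM}` (`N, M ≥ 1`) forces `p = q` (the arithmetic of seat abc-iut-L6-t20's `frobeniusCompact_core`);
* **`Birat.pnat_eq_of_isFrobeniusCompact_untrBirat`** — `λ`-RIGIDITY OF `(C^un-tr)^birat` IN DIVISOR FORM: if
  `A₀^birat` is Frobenius-compact, then for every base automorphism `θ` of `X = Base(A₀)` and `p, q ≥ 1`,
  "`θ^*` acts on `Φ^birat(X)` by `p/q`" (`∀ d ∈ Φ^birat(X), ∃ N ≥ 1, (θ^* d)^{qN} = d^{pN}`) implies `p = q`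
  — every `θ` LIFTS to an automorphism of `A₀^birat` (seat abc-iut-w4-d020's `Birat.exists_iso_of_baseIso`;
  `C^un-tr` is of isotropic type, `isOfIsotropicType_untr`), which then acts on all units by `p/q`, hence
  trivially, so the non-torsion unit is scaled both by `p/q` and by `1`;
* **`Birat.exists_isFrobeniusCompact_untrBirat_rlf`** — row (K): a Frobenius-compact object of
  `(C^un-tr)^birat` yields one of `((C^rlf)^un-tr)^birat` (for `Φ` perf-factorial, `C^rlf` a Frobenioid):
  at `Y` the units are `ℝ · Φ^birat(X)` through `Div`, commutative, with the non-torsion element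
  `ι(Div u₀)`; an automorphism `f` of `Y` scaling all units by `p/q` scales every `ι(d)`, `d ∈ Φ^birat(X)`,
  i.e. (injectivity and naturality of `ι`) `Base(f⁻¹)^*` scales every `d ∈ Φ^birat(X)` by `p/q`, so `p = q`
  by the previous item, and `f` acts trivially.
No definitions; no statement of the paper is strengthened (the hypothesis "not of group-like type" of the
printed sentence is not needed for this clause); nothing here bears on [IUTchIII] Cor. 3.12.
-/

namespace Literature.AlgebraicGeometry.Frobenioids

open CategoryTheory Opposite

universe w v v' u u'

/-! ### Arithmetic: two scalings of a non-torsion element -/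

/-- In a commutative group: if `d` is non-torsion, `P ^ N = d ^ N` and `P ^ (q M) = d ^ (p M)` with
`N, M ≥ 1`, then `p = q` (compare `d^{qMN} = P^{qMN} = d^{pMN}`). [cite: MochizukiFrdI2008, Def. 1.2 (iv) p.23] -/
theorem pnat_eq_of_pow_scaling {G : Type*} [CommGroup G] {d P : G} (hd : ∀ N : ℕ, 0 < N → d ^ N ≠ 1)
    {N M : ℕ} (hN : 0 < N) (hM : 0 < M) (p q : ℕ+) (h1 : P ^ N = d ^ N)
    (h2 : P ^ ((q : ℕ) * M) = d ^ ((p : ℕ) * M)) : p = q := by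
  have e3 : d ^ ((p : ℕ) * M * N) = d ^ ((q : ℕ) * M * N) := by
    rw [pow_mul, ← h2, ← pow_mul, show (q : ℕ) * M * N = N * ((q : ℕ) * M) from by ring, pow_mul, h1,
      ← pow_mul]
  apply PNat.coe_inj.mp
  by_contra hne
  rcases Nat.lt_or_gt_of_ne hne with hlt | hgt
  · have hsplit : (q : ℕ) * M * N = (p : ℕ) * M * N + ((q : ℕ) - p) * M * N := by
      rw [← Nat.add_mul, ← Nat.add_mul, Nat.add_sub_cancel' hlt.le]
    have e4 : d ^ ((p : ℕ) * M * N) * d ^ (((q : ℕ) - p) * M * N) = d ^ ((p : ℕ) * M * N) * 1 := by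
      rw [mul_one, ← pow_add, ← hsplit]
      exact e3.symm
    exact hd _ (Nat.mul_pos (Nat.mul_pos (Nat.sub_pos_of_lt hlt) hM) hN) (mul_left_cancel e4)
  · have hsplit : (p : ℕ) * M * N = (q : ℕ) * M * N + ((p : ℕ) - q) * M * N := by
      rw [← Nat.add_mul, ← Nat.add_mul, Nat.add_sub_cancel' hgt.le]
    have e4 : d ^ ((q : ℕ) * M * N) * d ^ (((p : ℕ) - q) * M * N) = d ^ ((q : ℕ) * M * N) * 1 := by
      rw [mul_one, ← pow_add, ← hsplit]
      exact e3
    exact hd _ (Nat.mul_pos (Nat.mul_pos (Nat.sub_pos_of_lt hgt) hM) hN) (mul_left_cancel e4)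

namespace PreFrobenioid

variable {D : Type u} [Category.{v} D] {Φ : Dᵒᵖ ⥤ CommMonCat.{w}}
  {C : Type u'} [Category.{v'} C] {F : C ⥤ ElemFrobenioid Φ}

open PreFrobenioidData (ofFunctor)

namespace Birat

/-! ### `λ`-rigidity of `(C^un-tr)^birat` in divisor form -/

/-- Units of `A^birat` for `A ∈ Ob(C^un-tr)` and their powers are read through the INJECTIVE divisor map:
`(toAut y ^ a) = (toAut x ^ b)` as soon as `Div(y)^a = Div(x)^b`. [cite: MochizukiFrdI2008, Prop. 4.4 (iii) p.83] -/
theorem toAut_pow_eq_of_divHom_pow_eq (hF : IsFrobenioid F) (A : (ofFunctor Φ F).Untr)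
    (x y : BiratUnits (untrFunctor hF) (isFrobenioid_untr hF) A) (a b : ℕ)
    (h : BiratUnits.divHom (isFrobenioid_untr hF) A y ^ a = BiratUnits.divHom (isFrobenioid_untr hF) A x ^ b) :
    BiratUnits.toAut (hasBiratSquares_untr hF) y ^ a = BiratUnits.toAut (hasBiratSquares_untr hF) x ^ b := by
  rw [← map_pow, ← map_pow]
  exact congrArg _ (divHom_untr_injective hF A (by rw [map_pow, map_pow, h]))

/-- **`λ`-rigidity of `(C^un-tr)^birat` in divisor form.**  If `A₀^birat` is a Frobenius-compact object of
`(C^un-tr)^birat` (Def. 1.2 (iv)), then a base automorphism `θ` of `X = Base(A₀)` whose pull-back acts on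
`Φ^birat(X)` by multiplication by `p/q` (up to torsion) has `p = q`: `θ` lifts to an automorphism `f` of
`A₀^birat` (isotropic type, Def. 1.3 (i)(b)), the conjugation by which acts on the units
`O^×(A₀^birat) ≅ Φ^birat(X)` as `θ^*` does, hence by `p/q`, hence trivially (Frobenius-compactness) — and
the non-torsion unit is then scaled both by `p/q` and by `1`. [cite: MochizukiFrdI2008, Def. 1.2 (iv) p.23] -/
theorem pnat_eq_of_isFrobeniusCompact_untrBirat (hF : IsFrobenioid F) (A₀ : (ofFunctor Φ F).Untr)
    (h0 : (biratOps (isFrobenioid_untr hF) (hasBiratSquares_untr hF)).IsFrobeniusCompact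
      ((toBirat (untrFunctor hF) (isFrobenioid_untr hF) (hasBiratSquares_untr hF)).obj A₀))
    (θ : baseObj (untrFunctor hF) A₀ ≅ baseObj (untrFunctor hF) A₀) (p q : ℕ+)
    (hθ : ∀ d ∈ biratSubgroup F (baseObj (untrFunctor hF) A₀), ∃ N : ℕ, 0 < N ∧
      pullGp Φ θ.hom d ^ ((q : ℕ) * N) = d ^ ((p : ℕ) * N)) :
    p = q := by
  obtain ⟨-, ⟨u₀, hu₀, hnt⟩, hlam⟩ := h0
  -- lift `θ⁻¹` to an automorphism `f` of `A₀^birat`; then `Base(f⁻¹) = θ`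
  obtain ⟨f, hf⟩ :
      ∃ g : Aut ((toBirat (untrFunctor hF) (isFrobenioid_untr hF) (hasBiratSquares_untr hF)).obj A₀),
        gpBase g.hom = θ.symm.hom :=
    exists_iso_of_baseIso (hF := isFrobenioid_untr hF) (hsq := hasBiratSquares_untr hF)
      (isOfIsotropicType_untr hF) A₀ A₀ θ.symm
  have hfinv : gpBase f.inv = θ.hom := by
    have h := BiratUnits.gpBase_inv_comp_hom (hF := isFrobenioid_untr hF) (hsq := hasBiratSquares_untr hF) f
    rw [hf] at h
    calc gpBase f.inv = gpBase f.inv ≫ (θ.symm.hom ≫ θ.hom) := by rw [Iso.symm_hom, Iso.inv_hom_id, Category.comp_id]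
      _ = θ.hom := by rw [← Category.assoc, h, Category.id_comp]
  -- every unit is a rational function; conjugation by `f` is `θ^*` on divisors
  have hconj : ∀ x : BiratUnits (untrFunctor hF) (isFrobenioid_untr hF) A₀,
      ∃ y : BiratUnits (untrFunctor hF) (isFrobenioid_untr hF) A₀,
        BiratUnits.toAut (hasBiratSquares_untr hF) y =
            f * BiratUnits.toAut (hasBiratSquares_untr hF) x * f⁻¹ ∧
          BiratUnits.divHom (isFrobenioid_untr hF) A₀ y =
            pullGp Φ θ.hom (BiratUnits.divHom (isFrobenioid_untr hF) A₀ x) := by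
    intro x
    obtain ⟨y, hy, hdy⟩ := exists_biratUnits_conj (isFrobenioid_untr hF) (hasBiratSquares_untr hF) f x
    exact ⟨y, hy, by rw [hdy, hfinv]⟩
  -- `f` acts on all units by `p/q`
  have hyp : ∀ w ∈ (biratOps (isFrobenioid_untr hF) (hasBiratSquares_untr hF)).unitsSubgroup _,
      ∃ N : ℕ, 0 < N ∧ ((f * w * f⁻¹) ^ (q : ℕ)) ^ N = (w ^ (p : ℕ)) ^ N := by
    intro w hw
    obtain ⟨x, hx⟩ := exists_toAut_eq (hasBiratSquares_untr hF) ⟨w, hw⟩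
    change BiratUnits.toAut _ x = w at hx
    have hd : BiratUnits.divHom (isFrobenioid_untr hF) A₀ x ∈ biratSubgroup F (baseObj (untrFunctor hF) A₀) := by
      rw [← range_divHom_untr hF A₀]; exact ⟨x, rfl⟩
    obtain ⟨N, hN, hEq⟩ := hθ _ hd
    obtain ⟨y, hy, hdy⟩ := hconj x
    refine ⟨N, hN, ?_⟩
    rw [← hx, ← hy, ← pow_mul, ← pow_mul]
    exact toAut_pow_eq_of_divHom_pow_eq hF A₀ x y _ _ (by rw [hdy, hEq])
  -- hence trivially; read both facts on the non-torsion unit `u₀ = [x₀]`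
  obtain ⟨N, hN, htriv⟩ := hlam f p q hyp u₀ hu₀
  obtain ⟨x₀, hx₀⟩ := exists_toAut_eq (hasBiratSquares_untr hF) ⟨u₀, hu₀⟩
  change BiratUnits.toAut _ x₀ = u₀ at hx₀
  obtain ⟨y₀, hy₀, hdy₀⟩ := hconj x₀
  have hd₀ : BiratUnits.divHom (isFrobenioid_untr hF) A₀ x₀ ∈ biratSubgroup F (baseObj (untrFunctor hF) A₀) := by
    rw [← range_divHom_untr hF A₀]; exact ⟨x₀, rfl⟩
  obtain ⟨M, hM, hEq₀⟩ := hθ _ hd₀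
  -- `Div(x₀)` is non-torsion
  have hnt' : ∀ K : ℕ, 0 < K → BiratUnits.divHom (isFrobenioid_untr hF) A₀ x₀ ^ K ≠ 1 := by
    intro K hK hK1
    refine hnt K hK ?_
    rw [← hx₀, ← map_pow]
    have : x₀ ^ K = 1 := divHom_untr_injective hF A₀ (by rw [map_pow, hK1, map_one])
    rw [this, map_one]
  -- `(θ^* Div x₀)^N = (Div x₀)^N` from the trivial action
  have h1 : pullGp Φ θ.hom (BiratUnits.divHom (isFrobenioid_untr hF) A₀ x₀) ^ N =
      BiratUnits.divHom (isFrobenioid_untr hF) A₀ x₀ ^ N := by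
    rw [← hdy₀, ← map_pow, ← map_pow]
    congr 1
    apply BiratUnits.toAut_injective (hsq := hasBiratSquares_untr hF)
    rw [map_pow, map_pow, hy₀, hx₀, htriv]
  exact pnat_eq_of_pow_scaling hnt' hN hM p q h1 hEq₀

/-! ### Row (K): a Frobenius-compact object of `((C^rlf)^un-tr)^birat` -/

open Literature.AnabelianGeometry.EtaleTheta (rlfFunctor)

/-- **[FrdI] Prop. 5.5 (iii), p. 105 ll. 20–22 — Def. 4.5 (iii)(b) for `C^rlf`**: if `(C^un-tr)^birat` admits a
Frobenius-compact object, then so does `((C^rlf)^un-tr)^birat` (for `Φ` perf-factorial and THE realification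
`C^rlf → F_{Φ^rlf}` a Frobenioid).  This is the hypothesis `hK` of
`FrdI.Prop55Sub.prop55iii_untr_rlf_ratStd'_of`, pointwise in `hR`. [cite: MochizukiFrdI2008, Prop. 5.5 (iii) p.105] -/
theorem exists_isFrobeniusCompact_untrBirat_rlf (hF : IsFrobenioid F) (hΦ : IsPerfFactorialOn Φ)
    (h0 : ∃ Y₀ : Birat (untrFunctor hF) (isFrobenioid_untr hF) (hasBiratSquares_untr hF),
      (biratOps (isFrobenioid_untr hF) (hasBiratSquares_untr hF)).IsFrobeniusCompact Y₀)
    (hR : IsFrobenioid (rlfToElem F hΦ)) :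
    ∃ Y : Birat (untrFunctor hR) (isFrobenioid_untr hR) (hasBiratSquares_untr hR),
      (PreFrobenioidData.ofFunctor (zeroMonoid D)
        (Birat.toElemZero (isFrobenioid_untr hR) (hasBiratSquares_untr hR))).IsFrobeniusCompact Y := by
  obtain ⟨Y₀, hY₀⟩ := h0
  -- notation: THE realification data
  have hΦ' := IsPerfFactorialOn.op hΦ
  let R := RealificationData.canonical Φ hΦ'
  let Ψ := biratSubfunctor F
  have hBg : Objectwise (fun M _ => IsGroupLike M) (R.realSpan Ψ).toMonoid := R.realSpan_toMonoid_isGroupLike Ψ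
  have hΦd : Objectwise (fun M _ => IsDivisorial M) R.rlf := RealificationData.canonical_rlf_isDivisorial hΦ'
  -- downstairs: `Y₀ = A₀^birat`, `X = Base(A₀)`
  let A₀ : (ofFunctor Φ F).Untr := Y₀.out
  have hA₀ : (biratOps (isFrobenioid_untr hF) (hasBiratSquares_untr hF)).IsFrobeniusCompact
      ((toBirat (untrFunctor hF) (isFrobenioid_untr hF) (hasBiratSquares_untr hF)).obj A₀) := hY₀
  let X : D := baseObj (untrFunctor hF) A₀
  -- upstairs: the object `(X, 1)` of `C^rlf`, isotropic, in `(C^rlf)^un-tr`, and its birationalization `Y`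
  let M₁ : rlf F hΦ := ⟨X, 1⟩
  have hM₁ : (ofFunctor _ (rlfToElem F hΦ)).IsIsotropic M₁ :=
    (PreFrobenioidData.ofFunctor_isIsotropic (rlfToElem F hΦ) M₁).mpr (ModelFrobenioid.isOfIsotropicType hBg M₁)
  let A₁ : (ofFunctor _ (rlfToElem F hΦ)).Untr := (ofFunctor _ (rlfToElem F hΦ)).toUntr.obj ⟨M₁, hM₁⟩
  let hU := isFrobenioid_untr hR
  let hsqU := hasBiratSquares_untr hR
  refine ⟨(toBirat (untrFunctor hR) hU hsqU).obj A₁, ?_⟩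
  -- `ι : Φ^gp(X) → (Φ^rlf)^gp(X)`, injective and natural, typed at the divisor groups of `A₀`, `A₁`
  let ι : PhiGp (untrFunctor hF) A₀ →* PhiGp (untrFunctor hR) A₁ := R.toRlfGp X
  have hιinj : Function.Injective ι := by
    haveI : IsCancelMul (R.rlf.obj (op X)) := IsPerfFactorial.Rlf.isCancelMul (hΦ' (op X))
    refine MonGp.map_injective _ ?_
    rw [RealificationData.canonical_toRlf]
    exact toRlfNatTrans_app_injective hΦ' (op X)
  have hnat : ∀ (g : X ⟶ X) (d : PhiGp (untrFunctor hF) A₀),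
      ι (pullGp Φ g d) = pullGp (rlfFunctor Φ hΦ') g (ι d) := fun g d => R.toRlfGp_pullGp g d
  -- the divisor map of `Y` is injective with image `ℝ · Φ^birat(X) ⊇ ι(Φ^birat(X))`
  have hinj := divHom_untr_injective hR A₁
  have hrange : ∀ d ∈ biratSubgroup F X, ∃ x : BiratUnits (untrFunctor hR) hU A₁,
      BiratUnits.divHom hU A₁ x = ι d := by
    intro d hd
    have hmem : ι d ∈ (BiratUnits.divHom hU A₁).range := by
      rw [range_divHom_untr hR A₁]
      exact (ModelFrobenioid.mem_biratSubgroup_iff_exists_divB hBg hΦd hR M₁ (R.toRlfGp X d)).mpr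
        ⟨⟨R.toRlfGp X d, R.toRlfGp_mem_realSpan Ψ X hd⟩, rfl⟩
    exact hmem
  -- downstairs data: a non-torsion unit `u₀ = [x₀]`; `d₀ := Div x₀ ∈ Φ^birat(X)` is non-torsion
  obtain ⟨-, ⟨u₀, hu₀, hnt⟩, -⟩ := hA₀
  obtain ⟨x₀, hx₀⟩ := exists_toAut_eq (hasBiratSquares_untr hF) ⟨u₀, hu₀⟩
  change BiratUnits.toAut _ x₀ = u₀ at hx₀
  have hd₀ : BiratUnits.divHom (isFrobenioid_untr hF) A₀ x₀ ∈ biratSubgroup F X := by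
    rw [← range_divHom_untr hF A₀]; exact ⟨x₀, rfl⟩
  have hnt₀ : ∀ K : ℕ, 0 < K → BiratUnits.divHom (isFrobenioid_untr hF) A₀ x₀ ^ K ≠ 1 := by
    intro K hK hK1
    refine hnt K hK ?_
    rw [← hx₀, ← map_pow]
    have : x₀ ^ K = 1 := divHom_untr_injective hF A₀ (by rw [map_pow, hK1, map_one])
    rw [this, map_one]
  obtain ⟨x₁, hx₁⟩ := hrange _ hd₀
  refine ⟨?_, ?_, ?_⟩
  · -- (1) `O^×(Y)` is commutative: `Div` is injective into an abelian group
    intro w hw w' hw'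
    obtain ⟨x, hx⟩ := exists_toAut_eq hsqU ⟨w, hw⟩
    obtain ⟨x', hx'⟩ := exists_toAut_eq hsqU ⟨w', hw'⟩
    change BiratUnits.toAut _ x = w at hx
    change BiratUnits.toAut _ x' = w' at hx'
    rw [← hx, ← hx', ← map_mul, ← map_mul]
    exact congrArg _ (hinj (by rw [map_mul, map_mul, mul_comm]))
  · -- (2) the unit `[x₁]` with `Div x₁ = ι(Div x₀)` is non-torsion
    refine ⟨BiratUnits.toAut hsqU x₁, toAut_mem_unitsSubgroup x₁, fun N hN hN1 => hnt₀ N hN (hιinj ?_)⟩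
    have hx1N : x₁ ^ N = 1 :=
      BiratUnits.toAut_injective (hsq := hsqU) (by rw [map_pow, hN1, map_one])
    have h2 : ι (BiratUnits.divHom (isFrobenioid_untr hF) A₀ x₀) ^ N = 1 := by
      rw [← hx₁, ← map_pow, hx1N, map_one]
    rw [map_pow, map_one]
    exact h2
  · -- (3) an automorphism acting on the units by `p/q` has `p = q`, hence acts trivially
    intro f p q hyp w hw
    -- `θ := Base(f⁻¹)` as a base automorphism of `X`
    let θ : X ≅ X :=
      { hom := gpBase (hF := hU) (hsq := hsqU) f.inv
        inv := gpBase (hF := hU) (hsq := hsqU) f.hom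
        hom_inv_id := BiratUnits.gpBase_inv_comp_hom (hF := hU) (hsq := hsqU) f
        inv_hom_id := BiratUnits.gpBase_hom_comp_inv (hF := hU) (hsq := hsqU) f }
    -- `θ^*` acts on `Φ^birat(X)` by `p/q`
    have hθ : ∀ d ∈ biratSubgroup F X, ∃ N : ℕ, 0 < N ∧
        pullGp Φ θ.hom d ^ ((q : ℕ) * N) = d ^ ((p : ℕ) * N) := by
      intro d hd
      obtain ⟨x, hx⟩ := hrange d hd
      obtain ⟨N, hN, hEq⟩ := hyp (BiratUnits.toAut hsqU x) (toAut_mem_unitsSubgroup x)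
      obtain ⟨y, hy, hdy⟩ := exists_biratUnits_conj hU hsqU f x
      refine ⟨N, hN, hιinj ?_⟩
      have key : y ^ ((q : ℕ) * N) = x ^ ((p : ℕ) * N) := by
        apply BiratUnits.toAut_injective (hsq := hsqU)
        rw [map_pow, map_pow, hy, pow_mul, pow_mul, hEq]
      have key2 := congrArg (BiratUnits.divHom hU A₁) key
      rw [map_pow, map_pow, hdy, hx] at key2
      rw [map_pow, map_pow, hnat]
      exact key2
    have hpq : p = q := pnat_eq_of_isFrobeniusCompact_untrBirat hF A₀ hY₀ θ p q hθ
    obtain ⟨N, hN, hEq⟩ := hyp w hw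
    refine ⟨(p : ℕ) * N, Nat.mul_pos p.pos hN, ?_⟩
    rw [pow_mul, pow_mul]
    rw [← hpq] at hEq
    exact hEq

end Birat

end PreFrobenioid

end Literature.AlgebraicGeometry.Frobenioids
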